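import Literature.IUT.HodgeArakelov.EtaleThetaDataOfSettingAutActionInner
import Literature.IUT.HodgeArakelov.PointedInversionOfSetting

/-!
# [IUTchII] Prop 2.2 (i), the `ι`-CLAUSE in its printed OUTER form — DERIVED from Rmk 1.4.1 (ii)'s characterisation of `ι`

Proof-only companion (abc-iut cell, WAVE-4 seat abc-iut-w4-d010 gen 6; cone of [IUTchIII] Cor. 3.12; DAG node
**IUTchII:Prop2.2(i)** — clause «(Π_{v•} ⊆ Π_{v▶} ⊆ Π_v, ι), regarded up to Π_v-conjugacy, may be reconstructed via a
functorial group-theoretic algorithm from the topological group Π_v», kurims p. 66 l. 48–50; plan/GAP-LEDGER.md row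
G-w5d169-1 names this lineage as owner of the `ι`-component of that clause). S. Mochizuki, *Inter-universal Teichmüller
theory II*, kurims manuscript (Dec. 2020): Rmk. 1.4.1 (ii) p. 28 («the unique order two automorphism `ι_X̲̲` of `X̲̲_k`
over `k` … corresponds at the level of tempered fundamental groups [cf., e.g., [SemiAnbd], Theorem 6.4] to the unique
order two `Δ^tp_{X̲̲_k}`-outer automorphism of `Π^tp_{X̲̲_k}` over `G_k`»), Prop. 2.2 (i) p. 66, Prop. 3.1 (i) p. 87
(claim key `Mochizuki2012`, DISPUTED, D-0012). No definitions, no `Prop`-valued definition, no named fact. Nothing here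
takes a side on [IUTchIII] Cor. 3.12; typed ≠ proved.

WHAT IS PROVED.
* §1 `exists_kerConj_conj_of_unique_outerOrderTwo` — pure group theory: if `ι` is, modulo `Δ := Ker f`-inner
  automorphisms, THE unique order-two topological automorphism of `Π` over `G` (`f : Π →* G`), then for EVERY topological
  automorphism `α` of `Π` mapping `Δ` onto itself there is `δ ∈ Δ` with `α ∘ ι ∘ α⁻¹ = conj_δ ∘ ι` (the transported
  automorphism is again over `G`, of outer order two and not `Δ`-inner, so uniqueness applies).
* §2 `PointedInversion.exists_deltaConj_of_aut` — for ANY inhabitant `ι₀ : PointedInversion E D` of abc-iut-L6-t1's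
  Rmk 1.4.1 (ii) output type (`MonoThetaProjective.lean`, FROZEN; its field `iota_unique` IS the printed characterisation)
  and any `Δ`-stable `α ∈ Aut_top(Π)` (`Δ = Ker(Π ≅ Π_X(M^Θ(Π)) ↠ G)`; `Δ`-stability is the «`(Π^tp_X ⊇) G_K` [i.e. `Δ_X`]»
  clause of [EtTh] Cor. 2.18 (i), FACT-LIST F-0620 class): `∃ δ ∈ Δ, α ∘ ι₀ ∘ α⁻¹ = conj_δ ∘ ι₀` — functoriality of the
  datum `ι` «regarded up to conjugacy» in the topological group `Π_v`, i.e. the `ι`-clause of Prop. 2.2 (i) read as a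
  statement about the `Δ`-OUTER automorphism `ι` (Rmk. 1.4.1 (ii): `ι_Ÿ ∈ Aut(Π^tp_Ÿ̲)/Inn(Δ^tp_Ÿ̲)`).
* §3 the same at the MODEL `Π := Π^tp_X̲̲ = Pi C` in abc-iut-w5-d072's binder shapes of `pointedInversionOfPair`
  (`hover`, `δ/hδ/hαα`, `γ/hγ/hαγ`, `huniq`; `iota_not_inner` from `not_inner_of_toLZ`), and
* §4 its COHOMOLOGICAL form for abc-iut-w5-d169's `Π`-intrinsic action `ρ_· := autActOfCor218i` on
  `lim_J H¹(Π^tp_Ÿ̲̲ ∩ J, l·Δ_Θ)` (p428996, p430185 BY NAME): `ρ_α ∘ ρ_{ι₀} ∘ ρ_α⁻¹ = h1LimConj δ ∘ ρ_{ι₀}`, `δ ∈ Δ`.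
HONEST READING. G-w5d169-1's binder `hconj : ∀ α ∃ c, α ∘ ι₀ ∘ α⁻¹ = conj_c ∘ ι₀ ∘ conj_c⁻¹` («the transported inversion
lies in ONE `Π_v`-conjugacy orbit of representatives») is this functoriality PLUS «the `Δ`-outer class of `ι₀` is a single
`Π_v`-orbit of representatives» — the extra part is not asserted by Rmk. 1.4.1 (ii)/Prop. 2.2 (i) and is NOT derived here
(cf. abc-iut-w6-d002's saturated index set, `ThetaEnvDataRecordAutSaturated.lean`, which needs neither).
-/

noncomputable section

namespace Literature.IUT.HodgeArakelov

universe u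

/-! ### §1. Pure group theory: functoriality of a unique outer involution -/

section Generic

variable {P : Type*} [Group P] [TopologicalSpace P] {Γ : Type*} [Group Γ] (f : P →* Γ)

/-- **Functoriality of THE unique order-two `Ker f`-outer automorphism over `G`.** Let `f : Π →* G` and let `ι` be a
topological automorphism of `Π` over `G` (`f ∘ ι = f`), of order two modulo `Δ := Ker f`-inner automorphisms (`ι² = conj_δ`,
`δ ∈ Δ`; `ι ∉ conj(Δ)`), and UNIQUE as such up to `Δ`-inner automorphisms.  Then every topological automorphism `α` of `Π`
mapping `Δ` onto itself satisfies `α ∘ ι ∘ α⁻¹ = conj_δ ∘ ι` for some `δ ∈ Δ`: the transport `α ∘ ι ∘ α⁻¹` is again over `G`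
(as `ι(y)·y⁻¹ ∈ Δ` and `α(Δ) = Δ`), squares to `conj_{α(δ)}` and is not `Δ`-inner (else `ι` would be), so uniqueness applies.
[claim: Mochizuki2012, status: disputed] (IUTchII §1 Rmk 1.4.1 (ii), kurims p.28) -/
theorem exists_kerConj_conj_of_unique_outerOrderTwo (ι : P ≃ₜ* P) (hover : ∀ x, f (ι x) = f x)
    (hsq : ∃ δ : P, f δ = 1 ∧ ∀ x, ι (ι x) = δ * x * δ⁻¹)
    (hnot : ¬ ∃ δ : P, f δ = 1 ∧ ∀ x, ι x = δ * x * δ⁻¹)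
    (huniq : ∀ κ : P ≃ₜ* P, (∀ x, f (κ x) = f x) → (∃ δ : P, f δ = 1 ∧ ∀ x, κ (κ x) = δ * x * δ⁻¹) →
      (¬ ∃ δ : P, f δ = 1 ∧ ∀ x, κ x = δ * x * δ⁻¹) → ∃ δ : P, f δ = 1 ∧ ∀ x, κ x = δ * ι x * δ⁻¹)
    (α : P ≃ₜ* P) (hα : ∀ x, f (α x) = 1 ↔ f x = 1) :
    ∃ δ : P, f δ = 1 ∧ ∀ x, α (ι (α.symm x)) = δ * ι x * δ⁻¹ := by
  have key := huniq (α.symm.trans (ι.trans α)) ?_ ?_ ?_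
  · obtain ⟨δ, hδ, h⟩ := key
    exact ⟨δ, hδ, fun x => h x⟩
  · -- over `G`
    intro x
    rw [ContinuousMulEquiv.trans_apply, ContinuousMulEquiv.trans_apply]
    have h1 : f (ι (α.symm x) * (α.symm x)⁻¹) = 1 := by rw [map_mul, map_inv, hover, mul_inv_cancel]
    have h2 : f (α (ι (α.symm x) * (α.symm x)⁻¹)) = 1 := (hα _).mpr h1
    calc f (α (ι (α.symm x))) = f (α (ι (α.symm x) * (α.symm x)⁻¹ * α.symm x)) := by rw [inv_mul_cancel_right]
      _ = f (α (ι (α.symm x) * (α.symm x)⁻¹)) * f (α (α.symm x)) := by rw [map_mul α, map_mul f]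
      _ = f x := by rw [h2, one_mul, ContinuousMulEquiv.apply_symm_apply]
  · -- outer order two
    obtain ⟨δ, hδ, hιι⟩ := hsq
    refine ⟨α δ, (hα δ).mpr hδ, fun x => ?_⟩
    rw [ContinuousMulEquiv.trans_apply, ContinuousMulEquiv.trans_apply, ContinuousMulEquiv.trans_apply,
      ContinuousMulEquiv.trans_apply, ContinuousMulEquiv.symm_apply_apply, hιι, map_mul, map_mul, map_inv,
      ContinuousMulEquiv.apply_symm_apply]
  · -- not `Δ`-inner
    rintro ⟨δ, hδ, hκ⟩
    apply hnot
    refine ⟨α.symm δ, (hα _).mp (by rwa [ContinuousMulEquiv.apply_symm_apply]), fun x => ?_⟩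
    have h := hκ (α x)
    rw [ContinuousMulEquiv.trans_apply, ContinuousMulEquiv.trans_apply, ContinuousMulEquiv.symm_apply_apply] at h
    apply α.injective
    rw [h, map_mul, map_mul, map_inv, ContinuousMulEquiv.apply_symm_apply]

/-- Pointwise-to-automorphism form: `α⁻¹ ≫ ι ≫ α = ι ≫ conj_δ` as topological automorphisms (for the tree's `conjCME`).
[claim: Mochizuki2012, status: disputed] (IUTchII §1 Rmk 1.4.1 (ii), kurims p.28) -/
theorem symm_trans_trans_eq_trans_conjCME_of_forall [IsTopologicalGroup P] (ι α : P ≃ₜ* P) (δ : P)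
    (h : ∀ x, α (ι (α.symm x)) = δ * ι x * δ⁻¹) :
    α.symm.trans (ι.trans α) =
      ι.trans (Literature.AnabelianGeometry.SemiGraphs.Thm68Sub.conjCME δ) :=
  ContinuousMulEquiv.ext fun x => by
    rw [ContinuousMulEquiv.trans_apply, ContinuousMulEquiv.trans_apply, ContinuousMulEquiv.trans_apply,
      Literature.AnabelianGeometry.SemiGraphs.Thm68Sub.conjCME_apply, h]

end Generic

/-! ### §2. The `ι`-clause of Prop 2.2 (i) for abc-iut-L6-t1's `PointedInversion` -/

section Interface

variable {S : ThetaSetting.{u}} {P : TopGroup.{u}} {E : EnvOfGroup S P} {D : EtaleThetaData S P}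

/-- **[IUTchII] Prop 2.2 (i), `ι`-clause, OUTER form — PROVED for every `ι₀ : PointedInversion E D`.** For every
topological automorphism `α` of `Π` mapping `Δ = Ker(Π ≅ Π_X(M^Θ(Π)) ↠ G)` onto itself ([EtTh] Cor. 2.18 (i) clause
«`(Π^tp_X ⊇) G_K` [i.e. `Δ_X`]», F-0620 class — a binder on `α`), the transported pointed inversion `α ∘ ι₀ ∘ α⁻¹` is a
`Δ`-conjugate `conj_δ ∘ ι₀` of `ι₀`: «the collection of data (…, ι), regarded up to Π_v-conjugacy, may be reconstructed
via a functorial group-theoretic algorithm from the topological group Π_v» — for the component `ι`, from Rmk. 1.4.1 (ii)'s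
«unique order two `Δ^tp`-outer automorphism over `G_k`» (the field `iota_unique`) alone.
[claim: Mochizuki2012, status: disputed] (IUTchII §2 Prop 2.2 (i), kurims p.66) -/
theorem PointedInversion.exists_deltaConj_of_aut (ι₀ : PointedInversion E D) (α : P ≃ₜ* P)
    (hα : ∀ x : P, E.recon.projG (E.isoX (α x)) = 1 ↔ E.recon.projG (E.isoX x) = 1) :
    ∃ δ : P, E.recon.projG (E.isoX δ) = 1 ∧ ∀ x : P, α (ι₀.iota (α.symm x)) = δ * ι₀.iota x * δ⁻¹ :=
  exists_kerConj_conj_of_unique_outerOrderTwo (E.recon.projG.comp E.isoX.toMulEquiv.toMonoidHom) ι₀.iota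
    ι₀.iota_over_G ι₀.iota_sq_inner ι₀.iota_not_inner ι₀.iota_unique α hα

/-- Equivalent phrasing with `α` on the right: `α ∘ ι₀ = conj_δ ∘ ι₀ ∘ α` for some `δ ∈ Δ`.
[claim: Mochizuki2012, status: disputed] (IUTchII §2 Prop 2.2 (i), kurims p.66) -/
theorem PointedInversion.exists_deltaConj_of_aut' (ι₀ : PointedInversion E D) (α : P ≃ₜ* P)
    (hα : ∀ x : P, E.recon.projG (E.isoX (α x)) = 1 ↔ E.recon.projG (E.isoX x) = 1) :
    ∃ δ : P, E.recon.projG (E.isoX δ) = 1 ∧ ∀ x : P, α (ι₀.iota x) = δ * ι₀.iota (α x) * δ⁻¹ := by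
  obtain ⟨δ, hδ, h⟩ := ι₀.exists_deltaConj_of_aut α hα
  refine ⟨δ, hδ, fun x => ?_⟩
  rw [← h (α x), ContinuousMulEquiv.symm_apply_apply]

/-- In particular the transported inversion has the SAME `Δ`-outer class: `α ∘ ι₀ ∘ α⁻¹ ∘ ι₀⁻¹` is conjugation by an
element of `Δ` (using `ι₀⁻¹ = conj_{δ₀⁻¹} ∘ ι₀`, `ι₀² = conj_{δ₀}`). [claim: Mochizuki2012, status: disputed]
(IUTchII §2 Prop 2.2 (i), kurims p.66) -/
theorem PointedInversion.exists_deltaConj_commutator_of_aut (ι₀ : PointedInversion E D) (α : P ≃ₜ* P)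
    (hα : ∀ x : P, E.recon.projG (E.isoX (α x)) = 1 ↔ E.recon.projG (E.isoX x) = 1) :
    ∃ δ : P, E.recon.projG (E.isoX δ) = 1 ∧ ∀ x : P, α (ι₀.iota (α.symm (ι₀.iota.symm x))) = δ * x * δ⁻¹ := by
  obtain ⟨δ, hδ, h⟩ := ι₀.exists_deltaConj_of_aut α hα
  refine ⟨δ, hδ, fun x => ?_⟩
  rw [h, ContinuousMulEquiv.apply_symm_apply]

end Interface

/-! ### §3. At the MODEL `Π := Π^tp_X̲̲` in the binder shapes of `pointedInversionOfPair` -/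

namespace EtaleThetaDataOfSetting

open Literature.AnabelianGeometry.EtaleTheta Literature.AnabelianGeometry.SemiGraphs CohomologySystemOfContH1
open Literature.AnabelianGeometry.SemiGraphs.Thm68Sub (conjCME conjCME_apply)

variable {p : ℕ} [Fact p.Prime] {D : Literature.AnabelianGeometry.EtaleTheta.ThetaSetting p}
  {E : D.EtaleThetaData} {l : ℕ} (C : E.DoubleUnderline l)

section Model

variable {S : ThetaSetting.{0}} (Env : EnvOfGroup S (Pi C)) (α₀ : (Pi C) ≃ₜ* (Pi C))
  (hover : ∀ x : Pi C, Env.recon.projG (Env.isoX (α₀ x)) = Env.recon.projG (Env.isoX x))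
  (δ : Pi C) (hδ : Env.recon.projG (Env.isoX δ) = 1) (hαα : ∀ x : Pi C, α₀ (α₀ x) = δ * x * δ⁻¹)
  (γ : Pi C) (hγ : C.toLZ γ = Multiplicative.ofAdd 1) (hαγ : C.toLZ (α₀ γ) = Multiplicative.ofAdd (-1))
  (huniq : ∀ κ : (Pi C) ≃ₜ* (Pi C),
    (∀ x : Pi C, Env.recon.projG (Env.isoX (κ x)) = Env.recon.projG (Env.isoX x)) →
    (∃ δ' : Pi C, Env.recon.projG (Env.isoX δ') = 1 ∧ ∀ x : Pi C, κ (κ x) = δ' * x * δ'⁻¹) →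
    (¬ ∃ δ' : Pi C, Env.recon.projG (Env.isoX δ') = 1 ∧ ∀ x : Pi C, κ x = δ' * x * δ'⁻¹) →
      ∃ δ' : Pi C, Env.recon.projG (Env.isoX δ') = 1 ∧ ∀ x : Pi C, κ x = δ' * α₀ x * δ'⁻¹)

include hover hδ hαα hγ hαγ huniq in
/-- **Prop 2.2 (i) `ι`-clause at the model**, for the pointed inversion `α₀` of `Π^tp_X̲̲` given in abc-iut-w5-d072's binder
shapes (over `G_k`: `hover`; outer order two: `δ, hδ, hαα`; `ℤ`-reversal at a generator: `γ, hγ, hαγ` — whence not inner,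
`not_inner_of_toLZ`; uniqueness: `huniq`): every `Δ`-stable topological automorphism `α` of `Π^tp_X̲̲` transports `α₀` to a
`Δ`-conjugate `conj_{δ'} ∘ α₀`. [claim: Mochizuki2012, status: disputed] (IUTchII §2 Prop 2.2 (i), kurims p.66) -/
theorem exists_deltaConj_of_aut_of_pair (α : (Pi C) ≃ₜ* (Pi C))
    (hα : ∀ x : Pi C, Env.recon.projG (Env.isoX (α x)) = 1 ↔ Env.recon.projG (Env.isoX x) = 1) :
    ∃ δ' : Pi C, Env.recon.projG (Env.isoX δ') = 1 ∧ ∀ x : Pi C, α (α₀ (α.symm x)) = δ' * α₀ x * δ'⁻¹ :=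
  exists_kerConj_conj_of_unique_outerOrderTwo (Env.recon.projG.comp Env.isoX.toMulEquiv.toMonoidHom) α₀ hover
    ⟨δ, hδ, hαα⟩ (not_inner_of_toLZ C α₀ γ hγ hαγ _) huniq α hα

include hover hδ hαα hγ hαγ huniq in
/-- … as an identity of topological automorphisms: `α⁻¹ ≫ α₀ ≫ α = α₀ ≫ conj_{δ'}`, `δ' ∈ Δ`.
[claim: Mochizuki2012, status: disputed] (IUTchII §2 Prop 2.2 (i), kurims p.66) -/
theorem exists_symm_trans_trans_eq_of_pair (α : (Pi C) ≃ₜ* (Pi C))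
    (hα : ∀ x : Pi C, Env.recon.projG (Env.isoX (α x)) = 1 ↔ Env.recon.projG (Env.isoX x) = 1) :
    ∃ δ' : Pi C, Env.recon.projG (Env.isoX δ') = 1 ∧ α.symm.trans (α₀.trans α) = α₀.trans (conjCME δ') := by
  obtain ⟨δ', hδ', h⟩ := exists_deltaConj_of_aut_of_pair C Env α₀ hover δ hδ hαα γ hγ hαγ huniq α hα
  exact ⟨δ', hδ', symm_trans_trans_eq_trans_conjCME_of_forall α₀ α δ' h⟩

/-! ### §4. Cohomological form for the `Π`-intrinsic action `autActOfCor218i` -/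

variable (hq : Topology.IsQuotientMap D.toTheta) {N : ℕ+} (μ : D.CyclotomeMod l N)

include hover hδ hαα hγ hαγ huniq in
/-- **The `ι`-clause on `lim_J H¹(Π^tp_Ÿ̲̲ ∩ J, l·Δ_Θ)`**: for the inversion action `ρ_{α₀} := autActOfCor218i α₀`
(abc-iut-w5-d169) and every `Δ`-stable `α ∈ Aut_top(Π^tp_X̲̲)`, `ρ_α ∘ ρ_{α₀} ∘ ρ_α⁻¹ = h1LimConj δ' ∘ ρ_{α₀}` for some
`δ' ∈ Δ` (inner automorphisms act by `h1LimConj`, `autActOfCor218i_conjCME`).  Compare binder (P2)/`hconj` of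
`orbitHyp_of_iotaConj` (G-w5d169-1), which asks for the STRONGER `h1LimConj c ∘ ρ_{α₀} ∘ h1LimConj c⁻¹`.
[claim: Mochizuki2012, status: disputed] (IUTchII §2 Prop 2.2 (i), kurims p.66) -/
theorem exists_autActOfCor218i_conj_eq_h1LimConj_of_pair [(PiYdd C).Normal] (hC : D.Compat) (hS : D.Sec2Hyps)
    (h15 : D.Prop15iii E hC) (L : C.CuspLabels) (R : RigidData.{0} N l) (hR : R = C.rigidData μ hC hS h15 L)
    (h218i : R.Cor218_i) (α : (Pi C) ≃ₜ* (Pi C))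
    (hα : ∀ x : Pi C, Env.recon.projG (Env.isoX (α x)) = 1 ↔ Env.recon.projG (Env.isoX x) = 1) :
    ∃ δ' : Pi C, Env.recon.projG (Env.isoX δ') = 1 ∧ ∀ x,
      autActOfCor218i C hq μ hC hS h15 L R hR h218i α
          (autActOfCor218i C hq μ hC hS h15 L R hR h218i α₀
            ((autActOfCor218i C hq μ hC hS h15 L R hR h218i α).symm x)) =
        h1LimConj (phi C) (D.lDeltaTheta l) (PiYdd C) δ' (autActOfCor218i C hq μ hC hS h15 L R hR h218i α₀ x) := by
  obtain ⟨δ', hδ', hγδ⟩ := exists_symm_trans_trans_eq_of_pair C Env α₀ hover δ hδ hαα γ hγ hαγ huniq α hα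
  refine ⟨δ', hδ', fun x => ?_⟩
  have key := autActOfCor218i_congr C hq μ hC hS h15 L R hR h218i hγδ x
  rw [autActOfCor218i_trans, autActOfCor218i_trans, autActOfCor218i_trans, autActOfCor218i_symm,
    autActOfCor218i_conjCME] at key
  exact key

include hover hδ hαα hγ hαγ huniq in
/-- The same with the variable substituted: `ρ_α (ρ_{α₀} x) = h1LimConj δ' (ρ_{α₀} (ρ_α x))` for all `x`.
[claim: Mochizuki2012, status: disputed] (IUTchII §2 Prop 2.2 (i), kurims p.66) -/
theorem exists_autActOfCor218i_inversion_eq_h1LimConj_of_pair [(PiYdd C).Normal] (hC : D.Compat) (hS : D.Sec2Hyps)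
    (h15 : D.Prop15iii E hC) (L : C.CuspLabels) (R : RigidData.{0} N l) (hR : R = C.rigidData μ hC hS h15 L)
    (h218i : R.Cor218_i) (α : (Pi C) ≃ₜ* (Pi C))
    (hα : ∀ x : Pi C, Env.recon.projG (Env.isoX (α x)) = 1 ↔ Env.recon.projG (Env.isoX x) = 1) :
    ∃ δ' : Pi C, Env.recon.projG (Env.isoX δ') = 1 ∧ ∀ x,
      autActOfCor218i C hq μ hC hS h15 L R hR h218i α (autActOfCor218i C hq μ hC hS h15 L R hR h218i α₀ x) =
        h1LimConj (phi C) (D.lDeltaTheta l) (PiYdd C) δ'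
          (autActOfCor218i C hq μ hC hS h15 L R hR h218i α₀ (autActOfCor218i C hq μ hC hS h15 L R hR h218i α x)) := by
  obtain ⟨δ', hδ', h⟩ :=
    exists_autActOfCor218i_conj_eq_h1LimConj_of_pair C Env α₀ hover δ hδ hαα γ hγ hαγ huniq hq μ hC hS h15 L R hR
      h218i α hα
  refine ⟨δ', hδ', fun x => ?_⟩
  rw [← h (autActOfCor218i C hq μ hC hS h15 L R hR h218i α x), AddEquiv.symm_apply_apply]

end Model


/-! ### §5. The `Δ`-stability binder for EVERY `α` from [EtTh] Cor. 2.18 (i) (F-0620) and ONE identification datum -/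

section FromCor218i

variable {S : ThetaSetting.{0}} (Env : EnvOfGroup S (Pi C)) (α₀ : (Pi C) ≃ₜ* (Pi C))
  (hover : ∀ x : Pi C, Env.recon.projG (Env.isoX (α₀ x)) = Env.recon.projG (Env.isoX x))
  (δ : Pi C) (hδ : Env.recon.projG (Env.isoX δ) = 1) (hαα : ∀ x : Pi C, α₀ (α₀ x) = δ * x * δ⁻¹)
  (γ : Pi C) (hγ : C.toLZ γ = Multiplicative.ofAdd 1) (hαγ : C.toLZ (α₀ γ) = Multiplicative.ofAdd (-1))
  (huniq : ∀ κ : (Pi C) ≃ₜ* (Pi C),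
    (∀ x : Pi C, Env.recon.projG (Env.isoX (κ x)) = Env.recon.projG (Env.isoX x)) →
    (∃ δ' : Pi C, Env.recon.projG (Env.isoX δ') = 1 ∧ ∀ x : Pi C, κ (κ x) = δ' * x * δ'⁻¹) →
    (¬ ∃ δ' : Pi C, Env.recon.projG (Env.isoX δ') = 1 ∧ ∀ x : Pi C, κ x = δ' * x * δ'⁻¹) →
      ∃ δ' : Pi C, Env.recon.projG (Env.isoX δ') = 1 ∧ ∀ x : Pi C, κ x = δ' * α₀ x * δ'⁻¹)
  (hq : Topology.IsQuotientMap D.toTheta) {N : ℕ+} (μ : D.CyclotomeMod l N)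

/-- **The «`(Π^tp_X ⊇) G_K` [i.e. `Δ_X`]» clause of [EtTh] Cor. 2.18 (i) at `C.rigidData`** (FACT-LIST F-0620, BY NAME):
every topological automorphism of `Π^tp_X̲̲` maps `Ker(aug) = Δ^tp_X ∩ Π^tp_X̲̲` onto itself — iff form, as for the other
clauses (`mem_ker_phi_iff_of_cor218_i` etc., abc-iut-w5-d169). [cite: MochizukiEtTh2009, Cor 2.18(i) p.60] -/
theorem mem_augKer_iff_of_cor218_i (hC : D.Compat) (hS : D.Sec2Hyps) (h15 : D.Prop15iii E hC)
    (L : C.CuspLabels) (R : RigidData.{0} N l) (hR : R = C.rigidData μ hC hS h15 L) (h218i : R.Cor218_i)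
    (α : (Pi C) ≃ₜ* (Pi C)) (x : Pi C) :
    x ∈ (C.rigidData μ hC hS h15 L).aug.ker ↔ α x ∈ (C.rigidData μ hC hS h15 L).aug.ker := by
  subst hR
  exact mem_iff_apply_mem_of_map_eq α.toMulEquiv _ (h218i α).2.2.1 x

/-- **Binder `hα` for EVERY `α ∈ Aut_top(Π^tp_X̲̲)`** from F-0620 and ONE identification datum `hEnv` («the `Δ` of the
Prop 1.2 (i) output `Env` — `Ker(Π ≅ Π_X(M^Θ(Π)) ↠ G)` — IS `Δ^tp_X ∩ Π^tp_X̲̲ = Ker(aug)` of the [EtTh] data»; identification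
only, as in abc-iut-w5-d086's Cor 2.3 bridge). [cite: MochizukiEtTh2009, Cor 2.18(i) p.60] -/
theorem projG_isoX_eq_one_iff_of_cor218_i (hC : D.Compat) (hS : D.Sec2Hyps) (h15 : D.Prop15iii E hC)
    (L : C.CuspLabels) (R : RigidData.{0} N l) (hR : R = C.rigidData μ hC hS h15 L) (h218i : R.Cor218_i)
    (hEnv : ∀ x : Pi C, Env.recon.projG (Env.isoX x) = 1 ↔ x ∈ (C.rigidData μ hC hS h15 L).aug.ker)
    (α : (Pi C) ≃ₜ* (Pi C)) (x : Pi C) :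
    Env.recon.projG (Env.isoX (α x)) = 1 ↔ Env.recon.projG (Env.isoX x) = 1 := by
  rw [hEnv, hEnv, ← mem_augKer_iff_of_cor218_i C μ hC hS h15 L R hR h218i α x]

/-- **[IUTchII] Prop 2.2 (i) `ι`-clause for EVERY topological automorphism of `Π^tp_X̲̲`**, for any inhabitant
`ι₀ : PointedInversion Env D'` of the Rmk 1.4.1 (ii) output type over the model group: modulo F-0620 (BY NAME) and the
identification `hEnv`, `α ∘ ι₀ ∘ α⁻¹ = conj_δ ∘ ι₀` with `δ ∈ Δ`. [claim: Mochizuki2012, status: disputed]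
(IUTchII §2 Prop 2.2 (i), kurims p.66) -/
theorem _root_.Literature.IUT.HodgeArakelov.PointedInversion.exists_deltaConj_of_aut_of_cor218_i
    {D' : EtaleThetaData S (Pi C)} (ι₀ : PointedInversion Env D')
    (hC : D.Compat) (hS : D.Sec2Hyps) (h15 : D.Prop15iii E hC)
    (L : C.CuspLabels) (R : RigidData.{0} N l) (hR : R = C.rigidData μ hC hS h15 L) (h218i : R.Cor218_i)
    (hEnv : ∀ x : Pi C, Env.recon.projG (Env.isoX x) = 1 ↔ x ∈ (C.rigidData μ hC hS h15 L).aug.ker)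
    (α : (Pi C) ≃ₜ* (Pi C)) :
    ∃ δ' : Pi C, Env.recon.projG (Env.isoX δ') = 1 ∧ ∀ x : Pi C, α (ι₀.iota (α.symm x)) = δ' * ι₀.iota x * δ'⁻¹ :=
  ι₀.exists_deltaConj_of_aut α (projG_isoX_eq_one_iff_of_cor218_i C Env μ hC hS h15 L R hR h218i hEnv α)

include hover hδ hαα hγ hαγ huniq in
/-- **The `ι`-clause at the model for EVERY `α ∈ Aut_top(Π^tp_X̲̲)`** (binder shapes of `pointedInversionOfPair`), modulo
F-0620 and `hEnv`. [claim: Mochizuki2012, status: disputed] (IUTchII §2 Prop 2.2 (i), kurims p.66) -/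
theorem exists_deltaConj_of_aut_of_cor218_i (hC : D.Compat) (hS : D.Sec2Hyps) (h15 : D.Prop15iii E hC)
    (L : C.CuspLabels) (R : RigidData.{0} N l) (hR : R = C.rigidData μ hC hS h15 L) (h218i : R.Cor218_i)
    (hEnv : ∀ x : Pi C, Env.recon.projG (Env.isoX x) = 1 ↔ x ∈ (C.rigidData μ hC hS h15 L).aug.ker)
    (α : (Pi C) ≃ₜ* (Pi C)) :
    ∃ δ' : Pi C, Env.recon.projG (Env.isoX δ') = 1 ∧ ∀ x : Pi C, α (α₀ (α.symm x)) = δ' * α₀ x * δ'⁻¹ :=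
  exists_deltaConj_of_aut_of_pair C Env α₀ hover δ hδ hαα γ hγ hαγ huniq α
    (projG_isoX_eq_one_iff_of_cor218_i C Env μ hC hS h15 L R hR h218i hEnv α)

include hover hδ hαα hγ hαγ huniq in
/-- **Cohomological `ι`-clause for EVERY `α ∈ Aut_top(Π^tp_X̲̲)`**: `ρ_α ∘ ρ_{α₀} = h1LimConj δ' ∘ ρ_{α₀} ∘ ρ_α` with
`δ' ∈ Δ`, modulo F-0620 (`h218i`, already the binder that DEFINES `ρ_α`) and the identification `hEnv` — the functoriality
of `ι` that Prop 2.2 (i) prints, for the action of abc-iut-w5-d169; no orbit hypothesis.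
[claim: Mochizuki2012, status: disputed] (IUTchII §2 Prop 2.2 (i), kurims p.66) -/
theorem exists_autActOfCor218i_inversion_eq_h1LimConj_of_cor218i [(PiYdd C).Normal] (hC : D.Compat)
    (hS : D.Sec2Hyps) (h15 : D.Prop15iii E hC) (L : C.CuspLabels) (R : RigidData.{0} N l)
    (hR : R = C.rigidData μ hC hS h15 L) (h218i : R.Cor218_i)
    (hEnv : ∀ x : Pi C, Env.recon.projG (Env.isoX x) = 1 ↔ x ∈ (C.rigidData μ hC hS h15 L).aug.ker)
    (α : (Pi C) ≃ₜ* (Pi C)) :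
    ∃ δ' : Pi C, Env.recon.projG (Env.isoX δ') = 1 ∧ ∀ x,
      autActOfCor218i C hq μ hC hS h15 L R hR h218i α (autActOfCor218i C hq μ hC hS h15 L R hR h218i α₀ x) =
        h1LimConj (phi C) (D.lDeltaTheta l) (PiYdd C) δ'
          (autActOfCor218i C hq μ hC hS h15 L R hR h218i α₀ (autActOfCor218i C hq μ hC hS h15 L R hR h218i α x)) :=
  exists_autActOfCor218i_inversion_eq_h1LimConj_of_pair C Env α₀ hover δ hδ hαα γ hγ hαγ huniq hq μ hC hS h15 L R hR
    h218i α (projG_isoX_eq_one_iff_of_cor218_i C Env μ hC hS h15 L R hR h218i hEnv α)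

end FromCor218i

end EtaleThetaDataOfSetting

end Literature.IUT.HodgeArakelov

end
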